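import Literature.NumberTheory.LFunctions.VanDerCorputZeta
import Literature.NumberTheory.LFunctions.DirichletPolynomialMeanValue
import Literature.NumberTheory.LFunctions.DirichletPolynomialGallagher
import HarnessLib

/-!
# The Halász–Montgomery inequality for Dirichlet polynomials (Matomäki–Radziwiłł 2016, Lemma 9)

Topic `Literature/NumberTheory/LFunctions`.  Everything in this file is PROVED; it discharges the named
fact `Literature.NumberTheory.LFunctions.MatomakiRadziwill2016_lemma9` of
`DirichletPolynomialMeanValue.lean` (K. Matomäki, M. Radziwiłł, *Multiplicative functions in short
intervals*, Ann. of Math. 183 (2016), §4, Lemma 9, "Halász inequality for integers": for a `1`-spaced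
`𝒯 ⊂ [-T, T]`, `∑_{t ∈ 𝒯} |∑_{n ≤ N} a_n n^{-it}|² ≪ (N + |𝒯| √T) log 2T ∑ |a_n|²`; "Proof. See [IK]",
i.e. Iwaniec–Kowalski, Thm 9.6 / Montgomery 1971), an input of the proof of MR's Proposition 1 (§8.3,
the sparse set of large values) and hence of `matomaki_radziwill`, `MatomakiRadziwillTao2015_propA3`,
`MatomakiRadziwillTao2015_theorem17`, ….

* `HalaszMontgomery.sum_norm_sq_dpoly_le_of_kernel_bound` — the duality inequality: if
  `∑_{t' ∈ 𝒯} |G(t - t')| ≤ B` for all `t ∈ 𝒯`, `G(τ) = ∑_{n ≤ N} n^{-iτ}` (`HalaszMontgomery.kernel`),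
  then `∑_{t ∈ 𝒯} |A(t)|² ≤ B ∑ |a_n|²` (Cauchy–Schwarz twice; IK (7.4)/(9.16)).
* `HalaszMontgomery.kl_block_far`, `HalaszMontgomery.vdc_block` — `|∑_{m ≤ n ≤ M} n^{-iu}| ≤ 8πM/u` for
  `u ≤ m` (Kusmin–Landau, `VdC.kusminLandau`) and `|∑_{M < n ≤ b} n^{-iu}| ≤ 12(4√(u/8π) + M√(8π/u))`
  for `b ≤ 2M` (van der Corput's second derivative test, `VdC.secondDerivTest`, with the phase family
  `VdC.phaseD`), whence by dyadic decomposition (`VdC.dyadic_bound`)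
  `HalaszMontgomery.norm_kernel_le_vdc_abs`: `|G(τ)| ≤ 1 + 72 √|τ| (log|τ|/log 2 + 1) + 101 N/|τ|`
  for `|τ| ≥ 1` — the classical `G(τ) ≪ N/|τ| + |τ|^{1/2} log|τ|`.
* `HalaszMontgomery.sum_inv_abs_sub_le` — `∑_{t' ∈ 𝒯, t' ≠ t} 1/|t - t'| ≤ 3 log(4T + 1)` over
  `1`-spaced points of `[-T, T]` (comparison with `∫ dy/(y-t)` over the disjoint windows
  `[t' - 1/2, t' + 1/2]`, via `Gallagher.sum_integral_le_integral_of_separated`).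
* `MatomakiRadziwill2016_lemma9_holds : MatomakiRadziwill2016_lemma9`, with the explicit constant `1000`.

## References
* K. Matomäki, M. Radziwiłł, Ann. of Math. (2) 183 (2016), 1015–1056 (arXiv:1501.04585), §4, Lemma 9.
  [cite: MatomakiRadziwillAnnals2016, Lemma 9]
* H. Iwaniec, E. Kowalski, *Analytic Number Theory*, AMS Coll. Publ. 53 (2004), Thm 9.6 and (7.4).
* S. W. Graham, G. Kolesnik, *Van der Corput's Method of Exponential Sums* (1991), Thms 2.1, 2.2
  (via `VanDerCorputZeta.lean`).

## Design choices
* `n^{-it}` is `(n : ℂ) ^ (-(t I))` as in the fact; the bridge to the `e(-(u/2π) log n)` normalisation of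
  `VanDerCorputZeta.lean` is `VdC.e_phaseD_zero`.
* Constants are explicit and crude (`72`, `101`, `300`, `1000`); only their existence matters downstream.
* `dpoly`, the `cpow`/`conj` helpers and the dyadic majorant are `private` (the first is the statement's
  inline sum, the second duplicate out-of-closure lemmas `Sieve.MatomakiRadziwillL4A.natCast_cpow_conj`,
  `HuxleyLV.conj_natCast_cpow`).
-/

noncomputable section

open Finset Real Complex MeasureTheory
open scoped ComplexConjugate

namespace Literature.NumberTheory.LFunctions

namespace HalaszMontgomery

/-! ### The Dirichlet polynomial and the kernel `G(τ) = ∑_{n ≤ N} n^{-iτ}` -/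

/-- The kernel `G(τ) = ∑_{n ≤ N} n^{-iτ}` (the Gram entries `⟨n^{-it}, n^{-it'}⟩ = G(t - t')`).
[folklore] -/
def kernel (N : ℕ) (τ : ℝ) : ℂ :=
  ∑ n ∈ Finset.Icc 1 N, (n : ℂ) ^ (-((τ : ℂ) * I))

/-- `conj (n^{s}) = n^{conj s}` for a natural number `n` (private copy of
`Sieve.MatomakiRadziwillL4A.natCast_cpow_conj` / `HuxleyLV.conj_natCast_cpow`, not in the import closure).
[folklore] -/
private theorem conj_natCast_cpow' (n : ℕ) (s : ℂ) : conj ((n : ℂ) ^ s) = (n : ℂ) ^ (conj s) := by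
  have h := Complex.conj_cpow (n : ℂ) (conj s) (by rw [Complex.natCast_arg]; exact Real.pi_ne_zero.symm)
  rw [Complex.conj_conj, Complex.conj_natCast] at h
  exact h.symm

/-- `conj (n^{-it}) = n^{it}`. [folklore] -/
private theorem conj_cpow_neg_mul_I (n : ℕ) (t : ℝ) :
    conj ((n : ℂ) ^ (-((t : ℂ) * I))) = (n : ℂ) ^ ((t : ℂ) * I) := by
  rw [conj_natCast_cpow']
  congr 1
  simp [Complex.conj_ofReal]

/-- `‖n^{-it}‖ = 1` for `n ≥ 1`. [folklore] -/
private theorem norm_cpow_neg_mul_I {n : ℕ} (hn : 1 ≤ n) (t : ℝ) : ‖(n : ℂ) ^ (-((t : ℂ) * I))‖ = 1 := by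
  rw [Complex.norm_natCast_cpow_of_pos (by omega)]
  simp

/-- `n^{-it} · conj(n^{-it'}) = n^{-i(t - t')}` for `n ≥ 1`. [folklore] -/
private theorem cpow_mul_conj_cpow {n : ℕ} (hn : 1 ≤ n) (t t' : ℝ) :
    (n : ℂ) ^ (-((t : ℂ) * I)) * conj ((n : ℂ) ^ (-((t' : ℂ) * I)))
      = (n : ℂ) ^ (-(((t - t' : ℝ) : ℂ) * I)) := by
  rw [conj_cpow_neg_mul_I, ← Complex.cpow_add _ _ (by exact_mod_cast (show n ≠ 0 by omega))]
  congr 1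
  push_cast; ring

/-- `G(-τ) = conj G(τ)`. [folklore] -/
theorem kernel_neg (N : ℕ) (τ : ℝ) : kernel N (-τ) = conj (kernel N τ) := by
  unfold kernel
  rw [map_sum]
  refine Finset.sum_congr rfl fun n _ => ?_
  rw [conj_cpow_neg_mul_I]
  congr 1; push_cast; ring

/-- `‖G(-τ)‖ = ‖G(τ)‖`. [folklore] -/
theorem norm_kernel_neg (N : ℕ) (τ : ℝ) : ‖kernel N (-τ)‖ = ‖kernel N τ‖ := by
  rw [kernel_neg, Complex.norm_conj]

/-- The trivial bound `‖G(τ)‖ ≤ N`. [folklore] -/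
theorem norm_kernel_le (N : ℕ) (τ : ℝ) : ‖kernel N τ‖ ≤ N := by
  unfold kernel
  have h : ∑ n ∈ Finset.Icc 1 N, ‖(n : ℂ) ^ (-((τ : ℂ) * I))‖ = N := by
    rw [Finset.sum_congr rfl fun n hn => norm_cpow_neg_mul_I (Finset.mem_Icc.1 hn).1 τ]
    simp
  exact (norm_sum_le _ _).trans h.le

/-! ### The abstract Halász–Montgomery (duality) inequality -/

/-- `A(t) = ∑_{n ≤ N} a_n n^{-it}` (proof-internal abbreviation). [folklore] -/
private def dpoly (N : ℕ) (a : ℕ → ℂ) (t : ℝ) : ℂ :=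
  ∑ n ∈ Finset.Icc 1 N, a n * (n : ℂ) ^ (-((t : ℂ) * I))

/-- **Duality form of the Halász–Montgomery inequality**: if `∑_{t' ∈ 𝒯} |G(t - t')| ≤ B` for every
`t ∈ 𝒯`, then `∑_{t ∈ 𝒯} |A(t)|² ≤ B ∑_n |a_n|²`.  Proof: with `c_t = A(t)`,
`∑ |c_t|² = ∑_n a_n d_n`, `d_n = ∑_t conj(c_t) n^{-it}`, Cauchy–Schwarz, and
`∑_n |d_n|² = ∑_{t,t'} conj(c_t) c_{t'} G(t - t') ≤ ∑_{t,t'} (|c_t|² + |c_{t'}|²)/2 |G(t-t')| ≤ B ∑|c_t|²`.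
[cite: IwaniecKowalski2004, Theorem 9.6 (proof; cf. (7.4))] -/
theorem sum_norm_sq_dpoly_le_of_kernel_bound (N : ℕ) (a : ℕ → ℂ) (𝒯 : Finset ℝ) {B : ℝ}
    (hB0 : 0 ≤ B) (hB : ∀ t ∈ 𝒯, ∑ t' ∈ 𝒯, ‖kernel N (t - t')‖ ≤ B) :
    ∑ t ∈ 𝒯, ‖∑ n ∈ Finset.Icc 1 N, a n * (n : ℂ) ^ (-((t : ℂ) * I))‖ ^ 2
      ≤ B * ∑ n ∈ Finset.Icc 1 N, ‖a n‖ ^ 2 := by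
  classical
  change ∑ t ∈ 𝒯, ‖dpoly N a t‖ ^ 2 ≤ B * ∑ n ∈ Finset.Icc 1 N, ‖a n‖ ^ 2
  set c : ℝ → ℂ := fun t => dpoly N a t with hc
  set S0 : ℝ := ∑ t ∈ 𝒯, ‖c t‖ ^ 2 with hS0
  set d : ℕ → ℂ := fun n => ∑ t ∈ 𝒯, conj (c t) * (n : ℂ) ^ (-((t : ℂ) * I)) with hd
  set Aa : ℝ := ∑ n ∈ Finset.Icc 1 N, ‖a n‖ ^ 2 with hAa
  have hS0nn : 0 ≤ S0 := Finset.sum_nonneg fun _ _ => sq_nonneg _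
  have hAann : 0 ≤ Aa := Finset.sum_nonneg fun _ _ => sq_nonneg _
  -- Step 1: `S0 = ∑_n a_n d_n`
  have step1 : (S0 : ℂ) = ∑ n ∈ Finset.Icc 1 N, a n * d n := by
    have e1 : (S0 : ℂ) = ∑ t ∈ 𝒯, conj (c t) * c t := by
      rw [hS0]; push_cast
      refine Finset.sum_congr rfl fun t _ => ?_
      rw [Complex.conj_mul']
    rw [e1]
    simp only [hd, Finset.mul_sum]
    rw [Finset.sum_comm]
    refine Finset.sum_congr rfl fun t _ => ?_
    simp only [hc, dpoly, Finset.mul_sum]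
    refine Finset.sum_congr rfl fun n _ => ?_
    ring
  -- Step 2: Cauchy–Schwarz `S0 ≤ √Aa √(∑ |d_n|²)`
  set Dd : ℝ := ∑ n ∈ Finset.Icc 1 N, ‖d n‖ ^ 2 with hDd
  have hDdnn : 0 ≤ Dd := Finset.sum_nonneg fun _ _ => sq_nonneg _
  have step2 : S0 ^ 2 ≤ Aa * Dd := by
    have h1 : S0 ≤ ∑ n ∈ Finset.Icc 1 N, ‖a n‖ * ‖d n‖ := by
      have : S0 = ‖(S0 : ℂ)‖ := by rw [Complex.norm_real, Real.norm_eq_abs, abs_of_nonneg hS0nn]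
      rw [this, step1]
      refine (norm_sum_le _ _).trans (Finset.sum_le_sum fun n _ => ?_)
      rw [norm_mul]
    have h2 := Finset.sum_mul_sq_le_sq_mul_sq (Finset.Icc 1 N) (fun n => ‖a n‖) (fun n => ‖d n‖)
    calc S0 ^ 2 ≤ (∑ n ∈ Finset.Icc 1 N, ‖a n‖ * ‖d n‖) ^ 2 := pow_le_pow_left₀ hS0nn h1 2
      _ ≤ Aa * Dd := h2
  -- Step 3: `∑ |d_n|² = ∑_{t,t'} conj(c_t) c_{t'} G(t - t')`, hence `≤ B S0`
  have step3 : Dd ≤ B * S0 := by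
    have e1 : (Dd : ℂ) = ∑ t ∈ 𝒯, ∑ t' ∈ 𝒯, conj (c t) * c t' * kernel N (t - t') := by
      rw [hDd]; push_cast
      have e2 : ∀ n ∈ Finset.Icc 1 N, ((‖d n‖ : ℂ)) ^ 2
          = ∑ t ∈ 𝒯, ∑ t' ∈ 𝒯, conj (c t) * c t' *
              ((n : ℂ) ^ (-((t : ℂ) * I)) * conj ((n : ℂ) ^ (-((t' : ℂ) * I)))) := by
        intro n hn
        rw [← Complex.conj_mul', mul_comm, hd]
        simp only [map_sum, map_mul, Complex.conj_conj, Finset.sum_mul, Finset.mul_sum]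
        rw [Finset.sum_comm]
        refine Finset.sum_congr rfl fun t _ => Finset.sum_congr rfl fun t' _ => ?_
        ring
      rw [Finset.sum_congr rfl e2, Finset.sum_comm]
      refine Finset.sum_congr rfl fun t _ => ?_
      rw [Finset.sum_comm]
      refine Finset.sum_congr rfl fun t' _ => ?_
      rw [kernel, Finset.mul_sum]
      refine Finset.sum_congr rfl fun n hn => ?_
      rw [cpow_mul_conj_cpow (Finset.mem_Icc.1 hn).1]
    have h1 : Dd ≤ ∑ t ∈ 𝒯, ∑ t' ∈ 𝒯, ‖c t‖ * ‖c t'‖ * ‖kernel N (t - t')‖ := by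
      have : Dd = ‖(Dd : ℂ)‖ := by rw [Complex.norm_real, Real.norm_eq_abs, abs_of_nonneg hDdnn]
      rw [this, e1]
      refine (norm_sum_le _ _).trans (Finset.sum_le_sum fun t _ => ?_)
      refine (norm_sum_le _ _).trans (Finset.sum_le_sum fun t' _ => ?_)
      rw [norm_mul, norm_mul, Complex.norm_conj]
    have h2 : ∀ t ∈ 𝒯, ∀ t' ∈ 𝒯, ‖c t‖ * ‖c t'‖ * ‖kernel N (t - t')‖
        ≤ (‖c t‖ ^ 2 / 2) * ‖kernel N (t - t')‖ + (‖c t'‖ ^ 2 / 2) * ‖kernel N (t' - t)‖ := by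
      intro t _ t' _
      rw [show t' - t = -(t - t') by ring, norm_kernel_neg]
      have := two_mul_le_add_sq ‖c t‖ ‖c t'‖
      nlinarith [norm_nonneg (kernel N (t - t')), norm_nonneg (c t), norm_nonneg (c t')]
    have h3 : ∑ t ∈ 𝒯, ∑ t' ∈ 𝒯, ‖c t‖ * ‖c t'‖ * ‖kernel N (t - t')‖
        ≤ ∑ t ∈ 𝒯, ∑ t' ∈ 𝒯, ((‖c t‖ ^ 2 / 2) * ‖kernel N (t - t')‖ + (‖c t'‖ ^ 2 / 2) * ‖kernel N (t' - t)‖) :=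
      Finset.sum_le_sum fun t ht => Finset.sum_le_sum fun t' ht' => h2 t ht t' ht'
    have h4 : ∑ t ∈ 𝒯, ∑ t' ∈ 𝒯, ((‖c t‖ ^ 2 / 2) * ‖kernel N (t - t')‖ + (‖c t'‖ ^ 2 / 2) * ‖kernel N (t' - t)‖)
        = ∑ t ∈ 𝒯, (‖c t‖ ^ 2 / 2) * ∑ t' ∈ 𝒯, ‖kernel N (t - t')‖
          + ∑ t' ∈ 𝒯, (‖c t'‖ ^ 2 / 2) * ∑ t ∈ 𝒯, ‖kernel N (t' - t)‖ := by
      have ea : ∀ t ∈ 𝒯, ∑ t' ∈ 𝒯, ((‖c t‖ ^ 2 / 2) * ‖kernel N (t - t')‖ + (‖c t'‖ ^ 2 / 2) * ‖kernel N (t' - t)‖)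
          = (‖c t‖ ^ 2 / 2) * ∑ t' ∈ 𝒯, ‖kernel N (t - t')‖
            + ∑ t' ∈ 𝒯, (‖c t'‖ ^ 2 / 2) * ‖kernel N (t' - t)‖ := by
        intro t _
        rw [Finset.sum_add_distrib, Finset.mul_sum]
      rw [Finset.sum_congr rfl ea, Finset.sum_add_distrib]
      congr 1
      rw [Finset.sum_comm]
      refine Finset.sum_congr rfl fun t' _ => ?_
      rw [Finset.mul_sum]
    have h5 : ∑ t ∈ 𝒯, (‖c t‖ ^ 2 / 2) * ∑ t' ∈ 𝒯, ‖kernel N (t - t')‖ ≤ ∑ t ∈ 𝒯, (‖c t‖ ^ 2 / 2) * B :=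
      Finset.sum_le_sum fun t ht => mul_le_mul_of_nonneg_left (hB t ht) (by positivity)
    have h6 : ∑ t ∈ 𝒯, (‖c t‖ ^ 2 / 2) * B = B * S0 / 2 := by
      rw [hS0, ← Finset.sum_mul, ← Finset.sum_div]; ring
    calc Dd ≤ _ := h1
      _ ≤ _ := h3
      _ = _ := h4
      _ ≤ ∑ t ∈ 𝒯, (‖c t‖ ^ 2 / 2) * B + ∑ t' ∈ 𝒯, (‖c t'‖ ^ 2 / 2) * B := add_le_add h5 (by
          exact Finset.sum_le_sum fun t ht => mul_le_mul_of_nonneg_left (hB t ht) (by positivity))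
      _ = B * S0 := by rw [h6]; ring
  -- Step 4: conclude
  have hfin : S0 ^ 2 ≤ Aa * (B * S0) := step2.trans (mul_le_mul_of_nonneg_left step3 hAann)
  change S0 ≤ B * Aa
  rcases eq_or_lt_of_le hS0nn with h0 | hpos
  · rw [← h0]; positivity
  · have : S0 * S0 ≤ (B * Aa) * S0 := by nlinarith
    exact le_of_mul_le_mul_right this hpos


/-! ### Bounds for the kernel `G(u) = ∑_{n ≤ N} n^{-iu}` by van der Corput's method -/

open VdC in
/-- The kernel in the `e(D₀ n)` normalisation of `VanDerCorputZeta`: `G(u) = ∑_{n ≤ N} e(phaseD u 0 n)`.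
[folklore] -/
theorem kernel_eq_sum_e (N : ℕ) (u : ℝ) :
    kernel N u = ∑ n ∈ Finset.Icc 1 N, e (phaseD u 0 n) := by
  unfold kernel
  refine Finset.sum_congr rfl fun n hn => ?_
  rw [e_phaseD_zero u (Finset.mem_Icc.1 hn).1]

open VdC in
/-- **Kusmin–Landau block far from the origin**: for `0 < u ≤ m ≤ M` (integers `m, M`),
`‖∑_{m ≤ n ≤ M} n^{-iu}‖ ≤ 8π M / u` (increments `-(u/2π) log(1+1/n) ∈ [-1 + δ, -δ]`,
`δ = u/(4πM)`). [cite: GrahamKolesnik1991, Thm 2.1 (Kusmin–Landau), applied to f(y) = -(u/2π) log y] -/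
theorem kl_block_far {u : ℝ} (hu : 0 < u) {m M : ℕ} (hm : u ≤ m) (hmM : m ≤ M) :
    ‖∑ n ∈ Finset.Icc (m : ℤ) M, e (phaseD u 0 n)‖ ≤ 8 * π * M / u := by
  have hπ : 3 < π := Real.pi_gt_three
  have hm0 : (0 : ℝ) < m := hu.trans_le hm
  have hM0 : (0 : ℝ) < M := hm0.trans_le (by exact_mod_cast hmM)
  have huM : u ≤ M := hm.trans (by exact_mod_cast hmM)
  set δ : ℝ := u / (4 * π * M) with hδdef
  have hδ : 0 < δ := by positivity
  have hδle : δ ≤ 1 / (4 * π) := by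
    rw [hδdef, div_le_div_iff₀ (by positivity) (by positivity)]
    nlinarith
  have hδ2 : δ ≤ 1 / 2 := hδle.trans (by
    rw [div_le_div_iff₀ (by positivity) (by norm_num)]; nlinarith)
  have key := kusminLandau (φ := fun n : ℤ => phaseD u 0 n) (m := m) (M := M) (ν := -1) hδ hδ2 ?_ ?_
  · calc ‖∑ n ∈ Finset.Icc (m : ℤ) M, e (phaseD u 0 n)‖ ≤ 2 / δ := key
      _ = 8 * π * M / u := by rw [hδdef]; field_simp; ring
  · -- increments in `[-1 + δ, -δ]`
    intro n h1 h2
    have hmn : (m : ℝ) ≤ n := by exact_mod_cast h1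
    have hn0 : (0 : ℝ) < n := hm0.trans_le hmn
    have hnu : u ≤ n := hm.trans hmn
    have hn1M : (n : ℝ) + 1 ≤ M := by
      have : n + 1 ≤ (M : ℤ) := h2
      have : ((n : ℤ) : ℝ) + 1 ≤ ((M : ℤ) : ℝ) := by exact_mod_cast this
      push_cast at this; linarith
    have hlog_up : Real.log (((n : ℝ) + 1) / n) ≤ 1 / n := by
      have := Real.log_le_sub_one_of_pos (by positivity : (0 : ℝ) < ((n : ℝ) + 1) / n)
      rwa [show ((n : ℝ) + 1) / n - 1 = 1 / n by field_simp; ring] at this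
    have hlog_low : 1 / ((n : ℝ) + 1) ≤ Real.log (((n : ℝ) + 1) / n) := by
      have := Real.one_sub_inv_le_log_of_pos (by positivity : (0 : ℝ) < ((n : ℝ) + 1) / n)
      rwa [show 1 - (((n : ℝ) + 1) / n)⁻¹ = 1 / ((n : ℝ) + 1) by field_simp; ring] at this
    have hθ : phaseD u 0 ((n + 1 : ℤ) : ℝ) - phaseD u 0 n
        = -(u / (2 * π)) * Real.log (((n : ℝ) + 1) / n) := by
      rw [phaseD_zero, phaseD_zero, Real.log_div (by positivity) hn0.ne']
      push_cast; ring
    rw [hθ]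
    have hc : 0 < u / (2 * π) := by positivity
    constructor
    · -- `-1 + δ ≤ -(u/2π) log(1 + 1/n)`: `(u/2π) log ≤ (u/2π)(1/n) ≤ 1/(2π)` and `δ ≤ 1/(4π)`
      have h3 : u / (2 * π) * Real.log (((n : ℝ) + 1) / n) ≤ 1 / (2 * π) := by
        calc u / (2 * π) * Real.log (((n : ℝ) + 1) / n) ≤ u / (2 * π) * (1 / n) :=
              mul_le_mul_of_nonneg_left hlog_up hc.le
          _ ≤ u / (2 * π) * (1 / u) := by
              apply mul_le_mul_of_nonneg_left _ hc.le
              exact one_div_le_one_div_of_le hu hnu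
          _ = 1 / (2 * π) := by field_simp
      have h4 : (1 : ℝ) / (2 * π) + 1 / (4 * π) ≤ 1 := by
        rw [div_add_div _ _ (by positivity) (by positivity), div_le_one (by positivity)]
        nlinarith
      push_cast
      linarith
    · -- `-(u/2π) log(1+1/n) ≤ -δ`: `log ≥ 1/(n+1) ≥ 1/M` and `(u/2π)/M = 2δ ≥ δ`
      have h3 : 2 * δ ≤ u / (2 * π) * Real.log (((n : ℝ) + 1) / n) := by
        calc 2 * δ = u / (2 * π) * (1 / M) := by rw [hδdef]; field_simp; ring
          _ ≤ u / (2 * π) * (1 / ((n : ℝ) + 1)) := by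
              apply mul_le_mul_of_nonneg_left _ hc.le
              exact one_div_le_one_div_of_le (by positivity) hn1M
          _ ≤ u / (2 * π) * Real.log (((n : ℝ) + 1) / n) :=
              mul_le_mul_of_nonneg_left hlog_low hc.le
      push_cast
      linarith
  · -- monotonicity of increments (concavity of `log`)
    intro n h1 h2
    have hn0 : (0 : ℝ) < n := by
      have : (m : ℝ) ≤ n := by exact_mod_cast h1
      linarith
    have hc : 0 < u / (2 * π) := by positivity
    simp only [phaseD_zero]
    push_cast
    have hlog : Real.log ((n : ℝ) + 2) + Real.log n ≤ 2 * Real.log ((n : ℝ) + 1) := by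
      rw [← Real.log_mul (by positivity) hn0.ne', ← Real.log_rpow (by positivity),
        Real.rpow_two]
      exact Real.log_le_log (by positivity) (by nlinarith)
    nlinarith [hlog, hc]

open VdC in
/-- **Second-derivative block**: for `u > 0` and integers `1 ≤ M ≤ b ≤ 2M`,
`‖∑_{M < n ≤ b} n^{-iu}‖ ≤ 12 (4 √(u/(8π)) + M √(8π/u))` (van der Corput's second derivative test
with `λ = u/(8π M²) ≤ f'' ≤ 4λ` for `f(y) = -(u/2π) log y` on `[M, 2M]`).
[cite: GrahamKolesnik1991, Thm 2.2 (van der Corput), applied to f(y) = -(u/2π) log y] -/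
theorem vdc_block {u : ℝ} (hu : 0 < u) {M b : ℕ} (hM : 1 ≤ M) (hMb : M ≤ b) (hb : b ≤ 2 * M) :
    ‖∑ n ∈ Finset.Ioc (M : ℤ) b, e (phaseD u 0 n)‖
      ≤ 12 * (4 * Real.sqrt (u / (8 * π)) + M * Real.sqrt (8 * π / u)) := by
  have hπ : 0 < π := Real.pi_pos
  have hM0 : (0 : ℝ) < M := by exact_mod_cast hM
  set lam : ℝ := u / (2 * π) * (Nat.factorial 1 : ℝ) / (2 * (M : ℝ)) ^ (1 + 1) with hlam
  have hlam' : lam = u / (8 * π * M ^ 2) := by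
    rw [hlam]; simp; ring
  have hlam0 : 0 < lam := by rw [hlam']; positivity
  have hD := phaseD_derivFamily u (a := (M : ℝ)) (b := (b : ℝ)) hM0 2
  have hf : ∀ y ∈ Set.Icc ((M : ℤ) : ℝ) ((b : ℤ) : ℝ), HasDerivAt (phaseD u 0) (phaseD u 1 y) y := by
    intro y hy
    exact hD 0 (by norm_num) y (by simpa using hy)
  have hf' : ∀ y ∈ Set.Icc ((M : ℤ) : ℝ) ((b : ℤ) : ℝ), HasDerivAt (phaseD u 1) (phaseD u 2 y) y := by
    intro y hy
    exact hD 1 (by norm_num) y (by simpa using hy)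
  have hbound : ∀ y ∈ Set.Icc ((M : ℤ) : ℝ) ((b : ℤ) : ℝ), lam ≤ phaseD u 2 y ∧ phaseD u 2 y ≤ 4 * lam := by
    intro y hy
    have hy' : y ∈ Set.Icc (M : ℝ) (2 * M) := by
      simp only [Int.cast_natCast, Set.mem_Icc] at hy
      exact ⟨hy.1, hy.2.trans (by exact_mod_cast hb)⟩
    have h := phaseD_bound u hu hM0 1 hy'
    have e1 : (-1 : ℝ) ^ (1 + 1) * phaseD u (1 + 1) y = phaseD u 2 y := by norm_num
    rw [e1] at h
    refine ⟨h.1, h.2.trans (le_of_eq ?_)⟩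
    norm_num [hlam]
  have hab : ((M : ℤ)) ≤ (b : ℤ) := by exact_mod_cast hMb
  have key := secondDerivTest (f := phaseD u 0) (f' := phaseD u 1) (f'' := phaseD u 2) hab hlam0
    (by norm_num : (1 : ℝ) ≤ 4) hf hf' hbound
  refine key.trans ?_
  have hsq : Real.sqrt lam = Real.sqrt u / (Real.sqrt (8 * π) * M) := by
    rw [hlam', Real.sqrt_div' _ (by positivity), Real.sqrt_mul (by positivity), Real.sqrt_sq hM0.le]
  have hbM : ((b : ℤ) : ℝ) - ((M : ℤ) : ℝ) ≤ M := by
    have : (b : ℝ) ≤ 2 * M := by exact_mod_cast hb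
    push_cast; linarith
  have hs8 : 0 < Real.sqrt (8 * π) := Real.sqrt_pos.2 (by positivity)
  have hsu : 0 < Real.sqrt u := Real.sqrt_pos.2 hu
  have e1 : 4 * (M : ℝ) * Real.sqrt lam = 4 * Real.sqrt (u / (8 * π)) := by
    rw [hsq, Real.sqrt_div' _ (by positivity)]; field_simp
  have e2 : 1 / Real.sqrt lam = M * Real.sqrt (8 * π / u) := by
    rw [hsq, Real.sqrt_div' _ hu.le]; field_simp
  calc 12 * (4 * (((b : ℤ) : ℝ) - ((M : ℤ) : ℝ)) * Real.sqrt lam + 1 / Real.sqrt lam)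
      ≤ 12 * (4 * (M : ℝ) * Real.sqrt lam + 1 / Real.sqrt lam) := by
        gcongr
    _ = 12 * (4 * Real.sqrt (u / (8 * π)) + M * Real.sqrt (8 * π / u)) := by rw [e1, e2]

/-- Numerics: `12 (4 √(u/(8π)) + M √(8π/u)) ≤ 72 √u` for `0 ≤ M ≤ u`. [folklore] -/
theorem vdc_block_numerics {u M : ℝ} (hu : 0 < u) (hM0 : 0 ≤ M) (hM : M ≤ u) :
    12 * (4 * Real.sqrt (u / (8 * π)) + M * Real.sqrt (8 * π / u)) ≤ 72 * Real.sqrt u := by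
  have hπ3 : 3 < π := Real.pi_gt_three
  have hπ4 : π < 3.15 := Real.pi_lt_d2
  have hsu : 0 < Real.sqrt u := Real.sqrt_pos.2 hu
  have hsu2 : Real.sqrt u ^ 2 = u := Real.sq_sqrt hu.le
  -- `24 √(u/(8π)) ≤ 5 √u` since `24² ≤ 25 · 8π`
  have h1 : 24 * Real.sqrt (u / (8 * π)) ≤ 5 * Real.sqrt u := by
    rw [show 24 * Real.sqrt (u / (8 * π)) = Real.sqrt (24 ^ 2 * (u / (8 * π))) by
          rw [Real.sqrt_mul (show (0:ℝ) ≤ 24 ^ 2 by norm_num) (u / (8 * π)), Real.sqrt_sq (by norm_num)],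
        show 5 * Real.sqrt u = Real.sqrt (5 ^ 2 * u) by
          rw [Real.sqrt_mul (show (0:ℝ) ≤ 5 ^ 2 by norm_num) u, Real.sqrt_sq (by norm_num)]]
    refine Real.sqrt_le_sqrt ?_
    rw [← mul_div_assoc, div_le_iff₀ (by positivity)]
    nlinarith
  -- `10 M √(8π/u) ≤ 51 √u` since `√(8π) ≤ 51/10` and `M ≤ u`
  have h8 : 10 * Real.sqrt (8 * π) ≤ 51 := by
    rw [show 10 * Real.sqrt (8 * π) = Real.sqrt (10 ^ 2 * (8 * π)) by
          rw [Real.sqrt_mul (show (0:ℝ) ≤ 10 ^ 2 by norm_num) (8 * π), Real.sqrt_sq (by norm_num)]]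
    rw [Real.sqrt_le_left (by norm_num)]
    nlinarith
  have h2 : 10 * (M * Real.sqrt (8 * π / u)) ≤ 51 * Real.sqrt u := by
    rw [Real.sqrt_div' _ hu.le]
    have hMu : M / Real.sqrt u ≤ Real.sqrt u := by
      rw [div_le_iff₀ hsu]; nlinarith
    calc 10 * (M * (Real.sqrt (8 * π) / Real.sqrt u)) = (10 * Real.sqrt (8 * π)) * (M / Real.sqrt u) := by
          ring
      _ ≤ 51 * Real.sqrt u := mul_le_mul h8 hMu (by positivity) (by norm_num)
  nlinarith [h1, h2, hsu]


/-- The block majorant of the dyadic decomposition: `72 √u` for blocks below `u`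
(second-derivative test), `16π M/u` for blocks `(M, 2M]` with `M ≥ u` (Kusmin–Landau). [folklore] -/
private def blockMajorant (u : ℝ) (M : ℕ) : ℝ :=
  if (M : ℝ) < u then 72 * Real.sqrt u else 16 * π * M / u

/-- `0 ≤ blockMajorant`. [folklore] -/
private theorem blockMajorant_nonneg {u : ℝ} (hu : 0 < u) (M : ℕ) : 0 ≤ blockMajorant u M := by
  unfold blockMajorant; split_ifs <;> positivity

open VdC in
/-- Each dyadic block `(2^i, min(2^{i+1}, N)]` is bounded by the majorant (`u > 0`). [folklore] -/
private theorem norm_block_le_blockMajorant {u : ℝ} (hu : 0 < u) (N i : ℕ) (hi : 2 ^ i < N) :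
    ‖∑ n ∈ Finset.Ioc (2 ^ i) (min (2 ^ (i + 1)) N), e (phaseD u 0 n)‖ ≤ blockMajorant u (2 ^ i) := by
  set M : ℕ := 2 ^ i with hM
  set b : ℕ := min (2 ^ (i + 1)) N with hb
  have hM1 : 1 ≤ M := Nat.one_le_two_pow
  have hMb : M ≤ b := by
    rw [hb, le_min_iff]; exact ⟨by rw [hM, pow_succ]; omega, hi.le⟩
  have hb2 : b ≤ 2 * M := by rw [hb, hM, pow_succ, mul_comm]; exact min_le_left _ _
  -- transfer the block sum to `ℤ`
  have htrans : ∑ n ∈ Finset.Ioc M b, e (phaseD u 0 n)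
      = ∑ n ∈ Finset.Ioc (M : ℤ) b, e (phaseD u 0 n) := by
    rw [sum_Ioc_int_eq_nat]
    refine Finset.sum_congr rfl fun n _ => ?_
    simp
  rw [htrans]
  unfold blockMajorant
  split_ifs with hlt
  · -- second derivative test
    refine (vdc_block hu hM1 hMb hb2).trans (vdc_block_numerics hu (by positivity) hlt.le)
  · -- Kusmin–Landau
    push Not at hlt
    have hm : u ≤ ((M + 1 : ℕ) : ℝ) := hlt.trans (by push_cast; linarith)
    rcases lt_or_ge b (M + 1) with hbM | hbM
    · have : b = M := by omega
      rw [this, Finset.Ioc_self, Finset.sum_empty, norm_zero]; positivity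
    · have h := kl_block_far hu hm hbM
      rw [show ((M + 1 : ℕ) : ℤ) = (M : ℤ) + 1 by push_cast; ring, Finset.Icc_add_one_left_eq_Ioc] at h
      refine h.trans ?_
      have hbR : (b : ℝ) ≤ 2 * M := by exact_mod_cast hb2
      rw [div_le_div_iff_of_pos_right hu]
      nlinarith [Real.pi_pos]

/-- The number of dyadic scales `2^i < u` below `I` is at most `log u / log 2 + 1` (`u ≥ 1`). [folklore] -/
theorem card_filter_two_pow_lt_le {u : ℝ} (hu : 1 ≤ u) (I : ℕ) :
    (#((Finset.range I).filter (fun i : ℕ => ((2 : ℝ) ^ i) < u)) : ℝ) ≤ Real.log u / Real.log 2 + 1 := by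
  have hlog2 : 0 < Real.log 2 := Real.log_pos (by norm_num)
  have hsub : (Finset.range I).filter (fun i : ℕ => ((2 : ℝ) ^ i) < u)
      ⊆ Finset.range (⌊Real.log u / Real.log 2⌋₊ + 1) := by
    intro i hi
    rw [Finset.mem_filter] at hi
    have h0 : 0 ≤ Real.log u / Real.log 2 := div_nonneg (Real.log_nonneg hu) hlog2.le
    rw [Finset.mem_range, Nat.lt_add_one_iff, Nat.le_floor_iff h0]
    rw [le_div_iff₀ hlog2, ← Real.log_pow]
    exact Real.log_le_log (by positivity) hi.2.le
  calc (#((Finset.range I).filter (fun i : ℕ => ((2 : ℝ) ^ i) < u)) : ℝ)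
      ≤ #(Finset.range (⌊Real.log u / Real.log 2⌋₊ + 1)) := by exact_mod_cast Finset.card_le_card hsub
    _ = ⌊Real.log u / Real.log 2⌋₊ + 1 := by rw [Finset.card_range]; push_cast; ring
    _ ≤ Real.log u / Real.log 2 + 1 := by
        have := Nat.floor_le (div_nonneg (Real.log_nonneg hu) hlog2.le)
        linarith

open VdC in
/-- **The kernel bound**: for `u ≥ 1`,
`‖∑_{n ≤ N} n^{-iu}‖ ≤ 1 + 72 √u (log u / log 2 + 1) + 101 N / u` (dyadic decomposition;
second-derivative test below `u`, Kusmin–Landau above). [folklore] -/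
theorem norm_kernel_le_vdc {u : ℝ} (hu : 1 ≤ u) (N : ℕ) :
    ‖kernel N u‖ ≤ 1 + 72 * Real.sqrt u * (Real.log u / Real.log 2 + 1) + 101 * N / u := by
  have hu0 : 0 < u := by linarith
  have hsu : 0 ≤ Real.sqrt u := Real.sqrt_nonneg u
  have hL : 0 ≤ Real.log u / Real.log 2 + 1 := by
    have := Real.log_nonneg hu; have := Real.log_pos (show (1:ℝ) < 2 by norm_num); positivity
  rcases Nat.eq_zero_or_pos N with hN | hN
  · subst hN
    simp only [kernel, CharP.cast_eq_zero, mul_zero, zero_div, add_zero]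
    rw [show Finset.Icc 1 0 = ∅ by rfl, Finset.sum_empty, norm_zero]
    positivity
  rw [kernel_eq_sum_e]
  -- split off `n = 1`
  have hsplit : ∑ n ∈ Finset.Icc 1 N, e (phaseD u 0 n)
      = e (phaseD u 0 (1 : ℕ)) + ∑ n ∈ Finset.Ioc 1 N, e (phaseD u 0 n) := by
    have hIcc : Finset.Icc 1 N = Finset.Ioc 0 N := by
      ext n; simp only [Finset.mem_Icc, Finset.mem_Ioc]; omega
    rw [hIcc, ← Finset.sum_Ioc_consecutive _ (Nat.zero_le 1) hN]
    simp
  rw [hsplit]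
  refine (norm_add_le _ _).trans ?_
  rw [norm_e]
  -- dyadic decomposition with `I = log₂ N + 1` scales
  set I : ℕ := Nat.log 2 N + 1 with hI
  have hNI : N ≤ 1 * 2 ^ I := by
    rw [one_mul, hI]; exact (Nat.lt_pow_succ_log_self (by norm_num) N).le
  have h2I : ((2 : ℝ) ^ I) ≤ 2 * N := by
    rw [hI, pow_succ]
    have := Nat.pow_log_le_self 2 hN.ne'
    have : ((2 ^ Nat.log 2 N : ℕ) : ℝ) ≤ N := by exact_mod_cast this
    push_cast at this; linarith
  have hdy := dyadic_bound (fun n : ℕ => e (phaseD u 0 n)) (blockMajorant u) (blockMajorant_nonneg hu0) N I 1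
    (fun i hi => by
      rw [one_mul] at hi
      simpa only [one_mul] using norm_block_le_blockMajorant hu0 N i hi) hNI
  simp only [one_mul] at hdy
  · have hsum : ∑ i ∈ Finset.range I, blockMajorant u (2 ^ i)
        ≤ 72 * Real.sqrt u * (Real.log u / Real.log 2 + 1) + 101 * N / u := by
      have e1 : ∀ i ∈ Finset.range I, blockMajorant u (2 ^ i)
          ≤ (if ((2 : ℝ) ^ i) < u then 72 * Real.sqrt u else 0) + 16 * π * (2 : ℝ) ^ i / u := by
        intro i _
        unfold blockMajorant
        push_cast
        split_ifs
        · have : 0 ≤ 16 * π * (2 : ℝ) ^ i / u := by positivity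
          linarith
        · simp
      refine (Finset.sum_le_sum e1).trans ?_
      rw [Finset.sum_add_distrib, ← Finset.sum_filter, Finset.sum_const, nsmul_eq_mul, ← Finset.sum_div,
        ← Finset.mul_sum]
      have hgeom : ∑ i ∈ Finset.range I, (2 : ℝ) ^ i ≤ 2 ^ I := by
        rw [geom_sum_eq (by norm_num)]; norm_num
      have hcard := card_filter_two_pow_lt_le hu I
      have t1 : (#((Finset.range I).filter (fun i : ℕ => ((2 : ℝ) ^ i) < u)) : ℝ) * (72 * Real.sqrt u)
          ≤ (Real.log u / Real.log 2 + 1) * (72 * Real.sqrt u) :=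
        mul_le_mul_of_nonneg_right hcard (by positivity)
      have t2 : (16 * π * ∑ i ∈ Finset.range I, (2 : ℝ) ^ i) / u ≤ 101 * N / u := by
        refine div_le_div_of_nonneg_right ?_ hu0.le
        have hπ : π < 3.15 := Real.pi_lt_d2
        nlinarith [hgeom, h2I, Real.pi_pos]
      linarith
    linarith [hdy.trans hsum]

/-- **The kernel bound for `|τ| ≥ 1`** (both signs). [folklore] -/
theorem norm_kernel_le_vdc_abs {τ : ℝ} (hτ : 1 ≤ |τ|) (N : ℕ) :
    ‖kernel N τ‖ ≤ 1 + 72 * Real.sqrt |τ| * (Real.log |τ| / Real.log 2 + 1) + 101 * N / |τ| := by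
  rcases le_or_gt 0 τ with h | h
  · rw [abs_of_nonneg h] at hτ ⊢; exact norm_kernel_le_vdc hτ N
  · rw [abs_of_neg h] at hτ ⊢
    rw [← norm_kernel_neg]
    exact norm_kernel_le_vdc hτ N


/-! ### Sums of `1/|t - t'|` over well-spaced points -/

/-- **One-sided harmonic bound over well-spaced points**: if the points of `𝒯` are pairwise `≥ 1`
apart, lie in `[-T, T]`, and `t ∈ [-T, T]`, then `∑_{t' ∈ 𝒯, t' ≥ t + 1} 1/(t' - t) ≤ (3/2) log(4T + 1)`.
Proof: `1/(t'-t) ≤ (3/2) ∫_{t'-1/2}^{t'+1/2} dy/(y - t)` and the windows are disjoint subintervals of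
`[t + 1/2, T + 1/2]` (`Gallagher.sum_integral_le_integral_of_separated`). [folklore] -/
theorem sum_inv_sub_le {𝒯 : Finset ℝ} {T t : ℝ} (ht : |t| ≤ T)
    (h𝒯 : ∀ t' ∈ 𝒯, |t'| ≤ T) (hsep : ∀ x ∈ 𝒯, ∀ y ∈ 𝒯, x ≠ y → 1 ≤ |x - y|) :
    ∑ t' ∈ 𝒯.filter (fun t' => t + 1 ≤ t'), 1 / (t' - t) ≤ 3 / 2 * Real.log (4 * T + 1) := by
  set S := 𝒯.filter (fun t' => t + 1 ≤ t') with hS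
  -- the continuous majorant `h(y) = 1 / max(y - t, 1/2)`
  set h : ℝ → ℝ := fun y => 1 / max (y - t) (1 / 2) with hh
  have hmax_pos : ∀ y, 0 < max (y - t) (1 / 2) := fun y => lt_max_of_lt_right (by norm_num)
  have hhc : Continuous h := by
    refine Continuous.div continuous_const ((continuous_id.sub continuous_const).max continuous_const) ?_
    exact fun y => (hmax_pos y).ne'
  have hh0 : ∀ y, 0 ≤ h y := fun y => by simp only [hh]; exact (one_div_pos.2 (hmax_pos y)).le
  have hsepS : ∀ x ∈ S, ∀ y ∈ S, x ≠ y → (1 : ℝ) ≤ |x - y| := fun x hx y hy hxy =>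
    hsep x (Finset.mem_filter.1 hx).1 y (Finset.mem_filter.1 hy).1 hxy
  have hmem : ∀ x ∈ S, (t + 1 / 2) + 1 / 2 ≤ x ∧ x ≤ (T + 1 / 2) - 1 / 2 := by
    intro x hx
    have hx' := Finset.mem_filter.1 hx
    refine ⟨by linarith [hx'.2], ?_⟩
    have := (abs_le.1 (h𝒯 x hx'.1)).2; linarith
  have htT : t + 1 / 2 ≤ T + 1 / 2 := by linarith [(abs_le.1 ht).2]
  have key := Gallagher.sum_integral_le_integral_of_separated hhc hh0 one_pos S hsepS
    (t + 1 / 2) (T + 1 / 2) htT hmem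
  -- each term: `1/(t'-t) ≤ (3/2) ∫_{t'-1/2}^{t'+1/2} h`
  have hterm : ∀ t' ∈ S, 1 / (t' - t) ≤ 3 / 2 * ∫ y in (t' - 1 / 2)..(t' + 1 / 2), h y := by
    intro t' ht'
    have hd : t + 1 ≤ t' := (Finset.mem_filter.1 ht').2
    have hlow : ∀ y ∈ Set.Icc (t' - 1 / 2) (t' + 1 / 2), 1 / (t' - t + 1 / 2) ≤ h y := by
      intro y hy
      simp only [hh]
      have hy1 : 1 / 2 ≤ y - t := by linarith [hy.1]
      rw [max_eq_left hy1]
      exact one_div_le_one_div_of_le (by linarith) (by linarith [hy.2])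
    have hint : ∫ y in (t' - 1 / 2)..(t' + 1 / 2), (1 / (t' - t + 1 / 2) : ℝ)
        ≤ ∫ y in (t' - 1 / 2)..(t' + 1 / 2), h y :=
      intervalIntegral.integral_mono_on (by linarith) intervalIntegrable_const
        (hhc.intervalIntegrable _ _) hlow
    rw [intervalIntegral.integral_const, smul_eq_mul, show t' + 1 / 2 - (t' - 1 / 2) = (1 : ℝ) by ring,
      one_mul] at hint
    have h32 : 1 / (t' - t) ≤ 3 / 2 * (1 / (t' - t + 1 / 2)) := by
      rw [mul_one_div, div_le_div_iff₀ (by linarith) (by linarith)]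
      linarith
    exact h32.trans (mul_le_mul_of_nonneg_left hint (by norm_num))
  -- the total integral is `log(2T + 1 - 2t) ≤ log(4T + 1)`
  have htot : ∫ y in (t + 1 / 2)..(T + 1 / 2), h y = Real.log (2 * T + 1 - 2 * t) := by
    have e1 : ∫ y in (t + 1 / 2)..(T + 1 / 2), h y = ∫ y in (t + 1 / 2)..(T + 1 / 2), 1 / (y - t) := by
      refine intervalIntegral.integral_congr fun y hy => ?_
      rw [Set.uIcc_of_le htT] at hy
      simp only [hh]
      rw [max_eq_left (by linarith [hy.1])]
    rw [e1, intervalIntegral.integral_comp_sub_right (fun y => 1 / y) t]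
    rw [show t + 1 / 2 - t = (1 / 2 : ℝ) by ring, integral_one_div_of_pos (by norm_num) (by
      linarith [(abs_le.1 ht).2])]
    congr 1
    field_simp
  calc ∑ t' ∈ S, 1 / (t' - t) ≤ ∑ t' ∈ S, 3 / 2 * ∫ y in (t' - 1 / 2)..(t' + 1 / 2), h y :=
        Finset.sum_le_sum hterm
    _ = 3 / 2 * ∑ t' ∈ S, ∫ y in (t' - 1 / 2)..(t' + 1 / 2), h y := by rw [Finset.mul_sum]
    _ ≤ 3 / 2 * ∫ y in (t + 1 / 2)..(T + 1 / 2), h y := mul_le_mul_of_nonneg_left key (by norm_num)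
    _ = 3 / 2 * Real.log (2 * T + 1 - 2 * t) := by rw [htot]
    _ ≤ 3 / 2 * Real.log (4 * T + 1) := by
        refine mul_le_mul_of_nonneg_left (Real.log_le_log (by linarith [(abs_le.1 ht).2]) ?_) (by norm_num)
        linarith [(abs_le.1 ht).1]

/-- **Two-sided harmonic bound over well-spaced points**:
`∑_{t' ∈ 𝒯, t' ≠ t} 1/|t' - t| ≤ 3 log(4T + 1)` for `t ∈ 𝒯 ⊂ [-T, T]` `1`-spaced. [folklore] -/
theorem sum_inv_abs_sub_le {𝒯 : Finset ℝ} {T t : ℝ} (ht𝒯 : t ∈ 𝒯)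
    (h𝒯 : ∀ t' ∈ 𝒯, |t'| ≤ T) (hsep : ∀ x ∈ 𝒯, ∀ y ∈ 𝒯, x ≠ y → 1 ≤ |x - y|) :
    ∑ t' ∈ 𝒯.erase t, 1 / |t' - t| ≤ 3 * Real.log (4 * T + 1) := by
  classical
  have ht : |t| ≤ T := h𝒯 t ht𝒯
  -- split `𝒯 ∖ {t}` into the points above and below `t`
  have hsplit : 𝒯.erase t = 𝒯.filter (fun t' => t + 1 ≤ t') ∪ 𝒯.filter (fun t' => t' ≤ t - 1) := by
    ext t'
    simp only [Finset.mem_erase, Finset.mem_union, Finset.mem_filter]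
    constructor
    · rintro ⟨hne, hmem⟩
      have h1 := hsep t' hmem t ht𝒯 hne
      rcases le_or_gt t t' with hle | hgt
      · left; refine ⟨hmem, ?_⟩
        rw [abs_of_nonneg (by linarith)] at h1; linarith
      · right; refine ⟨hmem, ?_⟩
        rw [abs_of_neg (by linarith)] at h1; linarith
    · rintro (⟨hmem, h1⟩ | ⟨hmem, h1⟩)
      · exact ⟨by intro h; subst h; linarith, hmem⟩
      · exact ⟨by intro h; subst h; linarith, hmem⟩
  have hdisj : Disjoint (𝒯.filter (fun t' => t + 1 ≤ t')) (𝒯.filter (fun t' => t' ≤ t - 1)) := by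
    rw [Finset.disjoint_filter]; intro x _ h1 h2; linarith
  rw [hsplit, Finset.sum_union hdisj]
  -- upper points
  have hup : ∑ t' ∈ 𝒯.filter (fun t' => t + 1 ≤ t'), 1 / |t' - t| ≤ 3 / 2 * Real.log (4 * T + 1) := by
    have e : ∀ t' ∈ 𝒯.filter (fun t' => t + 1 ≤ t'), 1 / |t' - t| = 1 / (t' - t) := by
      intro t' ht'
      rw [abs_of_nonneg (by linarith [(Finset.mem_filter.1 ht').2])]
    rw [Finset.sum_congr rfl e]
    exact sum_inv_sub_le ht h𝒯 hsep
  -- lower points, by reflection `x ↦ -x`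
  have hlow : ∑ t' ∈ 𝒯.filter (fun t' => t' ≤ t - 1), 1 / |t' - t| ≤ 3 / 2 * Real.log (4 * T + 1) := by
    set 𝒯' := 𝒯.image (fun x : ℝ => -x) with h𝒯'
    have hinj : Set.InjOn (fun x : ℝ => -x) ↑𝒯 := fun x _ y _ h => neg_injective h
    have h𝒯'abs : ∀ t' ∈ 𝒯', |t'| ≤ T := by
      intro t' ht'
      obtain ⟨x, hx, rfl⟩ := Finset.mem_image.1 ht'
      rw [abs_neg]; exact h𝒯 x hx
    have hsep' : ∀ x ∈ 𝒯', ∀ y ∈ 𝒯', x ≠ y → 1 ≤ |x - y| := by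
      intro x hx y hy hxy
      obtain ⟨x₀, hx₀, rfl⟩ := Finset.mem_image.1 hx
      obtain ⟨y₀, hy₀, rfl⟩ := Finset.mem_image.1 hy
      have := hsep x₀ hx₀ y₀ hy₀ (fun h => hxy (by rw [h]))
      rwa [show -x₀ - -y₀ = -(x₀ - y₀) by ring, abs_neg]
    have hneg : |(-t)| ≤ T := by rw [abs_neg]; exact ht
    have key := sum_inv_sub_le (𝒯 := 𝒯') (t := -t) hneg h𝒯'abs hsep'
    -- identify the two sums
    have e : ∑ t' ∈ 𝒯.filter (fun t' => t' ≤ t - 1), 1 / |t' - t|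
        = ∑ s ∈ 𝒯'.filter (fun s => -t + 1 ≤ s), 1 / (s - -t) := by
      rw [h𝒯', Finset.filter_image, Finset.sum_image (fun x hx y hy hxy => neg_injective hxy)]
      refine Finset.sum_congr ?_ fun x hx => ?_
      · ext x; simp only [Finset.mem_filter]
        constructor
        · rintro ⟨h1, h2⟩; exact ⟨h1, by linarith⟩
        · rintro ⟨h1, h2⟩; exact ⟨h1, by linarith⟩
      · have hx2 := (Finset.mem_filter.1 hx).2
        rw [abs_of_nonpos (by linarith)]
        congr 1; ring
    rw [e]
    exact key
  linarith

/-! ### Assembly: Matomäki–Radziwiłł's Lemma 9 -/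

/-- Numerical constants: `log(4T+1) ≤ 3 log(2T)`, `1 ≤ log(2T)/log 2`, and
`1 + 72 √(2T) (log(2T)/log 2 + 1) ≤ 300 √T log(2T)` for `T ≥ 1`. [folklore] -/
theorem lemma9_numerics {T : ℝ} (hT : 1 ≤ T) :
    Real.log (4 * T + 1) ≤ 3 * Real.log (2 * T) ∧ 1 ≤ Real.log (2 * T) / Real.log 2 ∧
    1 + 72 * Real.sqrt (2 * T) * (Real.log (2 * T) / Real.log 2 + 1) ≤ 300 * Real.sqrt T * Real.log (2 * T) := by
  have hlog2 : 0.6931471803 < Real.log 2 := Real.log_two_gt_d9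
  have hlog2' : Real.log 2 < 0.6931471808 := Real.log_two_lt_d9
  have hL : Real.log 2 ≤ Real.log (2 * T) := Real.log_le_log (by norm_num) (by linarith)
  have hL0 : 0 < Real.log (2 * T) := by linarith
  refine ⟨?_, ?_, ?_⟩
  · have e3 : Real.log ((2 * T) ^ 3) = 3 * Real.log (2 * T) := by
      rw [Real.log_pow]; norm_num
    rw [← e3]
    refine Real.log_le_log (by linarith) ?_
    nlinarith [mul_le_mul hT hT zero_le_one (by linarith : (0:ℝ) ≤ T)]
  · rw [le_div_iff₀ (by linarith)]; linarith
  · have hsT : 1 ≤ Real.sqrt T := by rw [show (1:ℝ) = Real.sqrt 1 by simp]; exact Real.sqrt_le_sqrt hT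
    have hs2 : Real.sqrt (2 * T) = Real.sqrt 2 * Real.sqrt T := Real.sqrt_mul (by norm_num) T
    have hsqrt2 : Real.sqrt 2 < 1.415 := by
      rw [Real.sqrt_lt' (by norm_num)]; norm_num
    have hratio : Real.log (2 * T) / Real.log 2 + 1 ≤ 2.886 * Real.log (2 * T) := by
      have h1 : Real.log (2 * T) / Real.log 2 ≤ 1.443 * Real.log (2 * T) := by
        rw [div_le_iff₀ (by linarith)]; nlinarith
      have h2 : (1 : ℝ) ≤ 1.443 * Real.log (2 * T) := by nlinarith
      linarith
    rw [hs2]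
    have h3 : 72 * (Real.sqrt 2 * Real.sqrt T) * (Real.log (2 * T) / Real.log 2 + 1)
        ≤ 72 * (1.415 * Real.sqrt T) * (2.886 * Real.log (2 * T)) := by
      refine mul_le_mul (mul_le_mul_of_nonneg_left ?_ (by norm_num)) hratio (by positivity) (by positivity)
      exact mul_le_mul_of_nonneg_right hsqrt2.le (by positivity)
    have h4 : (1 : ℝ) ≤ Real.sqrt T * Real.log (2 * T) * 1.45 := by nlinarith
    nlinarith

/-- **Matomäki–Radziwiłł 2016, Lemma 9 (Halász inequality for integers), proved**:
`∑_{t ∈ 𝒯} |∑_{n ≤ N} a_n n^{-it}|² ≤ 1000 (N + |𝒯| √T) log(2T) ∑ |a_n|²` for `𝒯 ⊂ [-T, T]`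
`1`-spaced, `N, T ≥ 1` ("Proof. See [IK]", i.e. Iwaniec–Kowalski Thm 9.6 / Montgomery 1971).
The duality inequality `sum_norm_sq_dpoly_le_of_kernel_bound` reduces the claim to
`max_t ∑_{t'} |G(t - t')|` with `G(τ) = ∑_{n ≤ N} n^{-iτ}`; `|G(0)| ≤ N`, and for `1 ≤ |τ| ≤ 2T`
`|G(τ)| ≤ 1 + 72√(2T)(log(2T)/log 2 + 1) + 101 N/|τ|` by van der Corput's method
(`norm_kernel_le_vdc_abs`: Kusmin–Landau above the scale `|τ|`, the second derivative test below it),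
while `∑_{t' ≠ t} 1/|t - t'| ≤ 3 log(4T+1) ≤ 9 log(2T)` over well-spaced points (`sum_inv_abs_sub_le`).
[cite: MatomakiRadziwillAnnals2016, Lemma 9] -/
theorem _root_.Literature.NumberTheory.LFunctions.MatomakiRadziwill2016_lemma9_holds :
    MatomakiRadziwill2016_lemma9 := by
  refine ⟨1000, ?_⟩
  intro N a T 𝒯 hN hT h𝒯 hsep
  classical
  have hT0 : 0 < T := by linarith
  obtain ⟨hnum1, hnum2, hnum3⟩ := lemma9_numerics hT
  have hL0 : 0 < Real.log (2 * T) := by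
    have := Real.log_pos (show (1:ℝ) < 2 by norm_num)
    have : Real.log 2 ≤ Real.log (2 * T) := Real.log_le_log (by norm_num) (by linarith)
    linarith
  set K : ℝ := 1 + 72 * Real.sqrt (2 * T) * (Real.log (2 * T) / Real.log 2 + 1) with hK
  have hK0 : 0 ≤ K := by
    have : 0 ≤ Real.log (2 * T) / Real.log 2 + 1 := by linarith
    positivity
  set B : ℝ := N + K * 𝒯.card + 101 * N * (3 * Real.log (4 * T + 1)) with hB
  -- the kernel sums
  have hker : ∀ t ∈ 𝒯, ∑ t' ∈ 𝒯, ‖kernel N (t - t')‖ ≤ B := by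
    intro t ht
    rw [← Finset.add_sum_erase _ _ ht, sub_self]
    have h0 : ‖kernel N 0‖ ≤ N := norm_kernel_le N 0
    have hrest : ∑ t' ∈ 𝒯.erase t, ‖kernel N (t - t')‖
        ≤ ∑ t' ∈ 𝒯.erase t, (K + 101 * N * (1 / |t' - t|)) := by
      refine Finset.sum_le_sum fun t' ht' => ?_
      have hne : t' ≠ t := (Finset.mem_erase.1 ht').1
      have ht'𝒯 : t' ∈ 𝒯 := (Finset.mem_erase.1 ht').2
      have hτ1 : 1 ≤ |t - t'| := hsep t ht t' ht'𝒯 hne.symm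
      have hτT : |t - t'| ≤ 2 * T := by
        calc |t - t'| ≤ |t| + |t'| := abs_sub _ _
          _ ≤ T + T := add_le_add (h𝒯 t ht) (h𝒯 t' ht'𝒯)
          _ = 2 * T := by ring
      have hv := norm_kernel_le_vdc_abs hτ1 N
      have hmono1 : Real.sqrt |t - t'| ≤ Real.sqrt (2 * T) := Real.sqrt_le_sqrt hτT
      have hmono2 : Real.log |t - t'| / Real.log 2 + 1 ≤ Real.log (2 * T) / Real.log 2 + 1 := by
        have := Real.log_le_log (by linarith) hτT
        have hl2 : 0 < Real.log 2 := Real.log_pos (by norm_num)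
        gcongr
      have hpos2 : 0 ≤ Real.log |t - t'| / Real.log 2 + 1 := by
        have := Real.log_nonneg hτ1
        have hl2 : 0 < Real.log 2 := Real.log_pos (by norm_num)
        positivity
      have hKτ : 1 + 72 * Real.sqrt |t - t'| * (Real.log |t - t'| / Real.log 2 + 1) ≤ K := by
        rw [hK]
        have := mul_le_mul (mul_le_mul_of_nonneg_left hmono1 (by norm_num : (0:ℝ) ≤ 72)) hmono2 hpos2
          (by positivity)
        linarith
      rw [abs_sub_comm] at hv hKτ
      calc ‖kernel N (t - t')‖ ≤ 1 + 72 * Real.sqrt |t' - t| * (Real.log |t' - t| / Real.log 2 + 1)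
            + 101 * N / |t' - t| := by rw [abs_sub_comm]; rw [abs_sub_comm] at hv; exact hv
        _ ≤ K + 101 * N * (1 / |t' - t|) := by rw [mul_one_div]; linarith
    rw [Finset.sum_add_distrib, Finset.sum_const, nsmul_eq_mul, ← Finset.mul_sum] at hrest
    have hharm := sum_inv_abs_sub_le ht h𝒯 hsep
    have hcard : ((𝒯.erase t).card : ℝ) * K ≤ 𝒯.card * K := by
      refine mul_le_mul_of_nonneg_right ?_ hK0
      exact_mod_cast Finset.card_erase_le
    have hN0 : (0 : ℝ) ≤ 101 * N := by positivity
    calc ‖kernel N 0‖ + ∑ t' ∈ 𝒯.erase t, ‖kernel N (t - t')‖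
        ≤ N + (((𝒯.erase t).card : ℝ) * K + 101 * N * ∑ t' ∈ 𝒯.erase t, 1 / |t' - t|) :=
          add_le_add h0 hrest
      _ ≤ N + (𝒯.card * K + 101 * N * (3 * Real.log (4 * T + 1))) := by
          gcongr
      _ = B := by rw [hB]; ring
  have hB0 : 0 ≤ B := by
    have : 0 ≤ Real.log (4 * T + 1) := Real.log_nonneg (by linarith)
    positivity
  have hmain := sum_norm_sq_dpoly_le_of_kernel_bound N a 𝒯 hB0 hker
  -- `B ≤ 1000 (N + |𝒯| √T) log(2T)`
  have hBle : B ≤ 1000 * (N + 𝒯.card * Real.sqrt T) * Real.log (2 * T) := by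
    have hN1 : (1 : ℝ) ≤ N := by exact_mod_cast hN
    have e1 : (N : ℝ) ≤ 2 * N * Real.log (2 * T) := by
      have : (1 : ℝ) ≤ 2 * Real.log (2 * T) := by
        have hl2 : 0.6931471803 < Real.log 2 := Real.log_two_gt_d9
        have : Real.log 2 ≤ Real.log (2 * T) := Real.log_le_log (by norm_num) (by linarith)
        linarith
      nlinarith
    have e2 : K * 𝒯.card ≤ 300 * Real.sqrt T * Real.log (2 * T) * 𝒯.card :=
      mul_le_mul_of_nonneg_right hnum3 (Nat.cast_nonneg _)
    have e3 : 101 * (N : ℝ) * (3 * Real.log (4 * T + 1)) ≤ 909 * N * Real.log (2 * T) := by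
      nlinarith
    have hsT : 0 ≤ Real.sqrt T := Real.sqrt_nonneg T
    rw [hB]
    nlinarith [mul_nonneg (Nat.cast_nonneg 𝒯.card) (mul_nonneg hsT hL0.le)]
  have hsum0 : 0 ≤ ∑ n ∈ Finset.Icc 1 N, ‖a n‖ ^ 2 := Finset.sum_nonneg fun _ _ => sq_nonneg _
  calc ∑ t ∈ 𝒯, ‖∑ n ∈ Finset.Icc 1 N, a n * (n : ℂ) ^ (-((t : ℂ) * I))‖ ^ 2
      ≤ B * ∑ n ∈ Finset.Icc 1 N, ‖a n‖ ^ 2 := hmain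
    _ ≤ 1000 * (N + 𝒯.card * Real.sqrt T) * Real.log (2 * T) * ∑ n ∈ Finset.Icc 1 N, ‖a n‖ ^ 2 :=
        mul_le_mul_of_nonneg_right hBle hsum0

end HalaszMontgomery

end Literature.NumberTheory.LFunctions
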